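import Summits.CriticalPhenomena.PercolationContinuityZ3.Theorems.PercNearOneGluingNoHeavyLowerTailKNGoodR3CaseLow
import HarnessLib

/-!
# `NoHeavyLowerTail` (stmt-CriticalPhenomena-4575) — universal goodness at `|A| = 3`: the real algebra of the
# reduction R3, case "middle" (`KNGoodR3.case_mid`)

Support file (`--supports stmt-CriticalPhenomena-4575`, hull-port prover `prim-hp-2`, gen 21).  No definitions, no named
facts, no sorries; pure real arithmetic.  Companion of `…KNGoodR3CaseLow.lean` (setting and notation there).  Inputs of the
case lemma: three two-world inequalities (pocket-augmented BHK, tree `KNGoodPocketBHK.core2`), the two loneliness rows of the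
designated relay, `α, β, δ ≥ 0`; null worlds handled by the vanishing of their cells.
[cite: KozmaNitzan2024, §3.2 (p. 12), proof of Thm. 3 (pp. 10–12)]
-/

namespace Summit.CriticalPhenomena.PercolationContinuityZ3.Theorems

namespace KNGoodR3

open Finset

variable {ι : Type*} [Fintype ι]

section CaseMid

variable [DecidableEq ι]

/-- **CASE c = the `T`-middle relay** (relays labelled `1 ≤_T 2 ≤_T 3`, relay `2` is the loneliest of `G`).
The goodness slack `−α m(d,1) + β m(d,3) − ε m(12,3) + γ m(13,13) − δ m(23,1) − Σ_i max(0, L_{i,1}, L_{i,3})`,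
`L_{i,1} = α p_d − γ p₁₃ + δ p₂₃`, `L_{i,3} = −β p_d + ε p₁₂ − γ p₁₃`, is `≥ 0`.
[cite: KozmaNitzan2024, §3.2 (p. 12), proof of Thm. 3 (pp. 10–12)] -/
theorem case_mid (α β γ δ ε Qd Q12 Q13 Q23 md1 md3 m12_3 m13_13 m23_1 : ℝ) (pd p12 p13 p23 : ι → ℝ)
    (hα : 0 ≤ α) (hβ : 0 ≤ β) (hδ : 0 ≤ δ)
    (hQd : 0 ≤ Qd) (hQ12 : 0 ≤ Q12) (hQ13 : 0 ≤ Q13) (hQ23 : 0 ≤ Q23)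
    (hmd1 : 0 ≤ md1) (hmd3 : 0 ≤ md3) (hm12_3 : 0 ≤ m12_3) (hm13_13 : 0 ≤ m13_13) (hm23_1 : 0 ≤ m23_1)
    (hpd : ∀ i, 0 ≤ pd i) (hp12 : ∀ i, 0 ≤ p12 i) (hp13 : ∀ i, 0 ≤ p13 i) (hp23 : ∀ i, 0 ≤ p23 i)
    (hTd : ∀ 𝒬 : Finset ι, md1 + md3 + ∑ i ∈ 𝒬, pd i ≤ Qd)
    (hT12 : ∀ 𝒬 : Finset ι, m12_3 + ∑ i ∈ 𝒬, p12 i ≤ Q12)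
    (hT13 : ∀ 𝒬 : Finset ι, m13_13 + ∑ i ∈ 𝒬, p13 i ≤ Q13)
    (hT23 : ∀ 𝒬 : Finset ι, m23_1 + ∑ i ∈ 𝒬, p23 i ≤ Q23)
    (hdeg : Qd = 0 → (Q12 = 0 ∧ Q13 = 0) ∨ (Q12 = 0 ∧ Q23 = 0) ∨ (Q13 = 0 ∧ Q23 = 0))
    (hI13b : ∀ 𝒬 : Finset ι, Q13 * (md1 + md3 + ∑ i ∈ 𝒬, pd i) ≤ Qd * (m13_13 + ∑ i ∈ 𝒬, p13 i))
    (hI12a : ∀ 𝒬 : Finset ι, Qd * (m12_3 + ∑ i ∈ 𝒬, p12 i) ≤ Q12 * (md3 + ∑ i ∈ 𝒬, pd i))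
    (hI23a : ∀ 𝒬 : Finset ι, Qd * (m23_1 + ∑ i ∈ 𝒬, p23 i) ≤ Q23 * (md1 + ∑ i ∈ 𝒬, pd i))
    -- the loneliness rows of relay 2
    (H1 : Qd * α + Q23 * δ ≤ Q13 * γ) (H3 : Q12 * ε ≤ Qd * β + Q13 * γ) :
    0 ≤ -α * md1 + β * md3 - ε * m12_3 + γ * m13_13 - δ * m23_1 -
      ∑ i, max 0 (max (α * pd i - γ * p13 i + δ * p23 i) (-β * pd i + ε * p12 i - γ * p13 i)) := by
  set L1 : ι → ℝ := fun i => α * pd i - γ * p13 i + δ * p23 i with hL1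
  set L3 : ι → ℝ := fun i => -β * pd i + ε * p12 i - γ * p13 i with hL3
  set Q1 := univ.filter (fun i => 0 ≤ L1 i ∧ L3 i ≤ L1 i) with hQ1
  set Q3 := univ.filter (fun i => 0 ≤ L3 i ∧ L1 i < L3 i) with hQ3
  have hsplit : ∑ i, max 0 (max (L1 i) (L3 i)) = ∑ i ∈ Q1, L1 i + ∑ i ∈ Q3, L3 i := sum_max_split L1 L3
  have hdis : Disjoint Q1 Q3 := disjoint_split L1 L3
  have e1 : ∑ i ∈ Q1, L1 i = α * (∑ i ∈ Q1, pd i) - γ * (∑ i ∈ Q1, p13 i) + δ * (∑ i ∈ Q1, p23 i) := by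
    simp only [hL1, Finset.sum_add_distrib, Finset.sum_sub_distrib, ← Finset.mul_sum]
  have e3 : ∑ i ∈ Q3, L3 i = -β * (∑ i ∈ Q3, pd i) + ε * (∑ i ∈ Q3, p12 i) - γ * (∑ i ∈ Q3, p13 i) := by
    simp only [hL3, Finset.sum_add_distrib, Finset.sum_sub_distrib, ← Finset.mul_sum]
  show 0 ≤ -α * md1 + β * md3 - ε * m12_3 + γ * m13_13 - δ * m23_1 - ∑ i, max 0 (max (L1 i) (L3 i))
  rw [hsplit, e1, e3]
  have b13 : Q13 * (md1 + md3 + (∑ i ∈ Q1, pd i + ∑ i ∈ Q3, pd i)) ≤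
      Qd * (m13_13 + (∑ i ∈ Q1, p13 i + ∑ i ∈ Q3, p13 i)) := by
    have := hI13b (Q1 ∪ Q3)
    rwa [Finset.sum_union hdis, Finset.sum_union hdis] at this
  have a12 := hI12a Q3
  have a23 := hI23a Q1
  have t13 : m13_13 + (∑ i ∈ Q1, p13 i + ∑ i ∈ Q3, p13 i) ≤ Q13 := by
    have := hT13 (Q1 ∪ Q3); rwa [Finset.sum_union hdis] at this
  have t12 := hT12 Q3
  have t23 := hT23 Q1
  have td : md1 + md3 + (∑ i ∈ Q1, pd i + ∑ i ∈ Q3, pd i) ≤ Qd := by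
    have := hTd (Q1 ∪ Q3); rwa [Finset.sum_union hdis] at this
  set Pd1 := ∑ i ∈ Q1, pd i with hPd1
  set Pd3 := ∑ i ∈ Q3, pd i with hPd3
  set P13_1 := ∑ i ∈ Q1, p13 i with hP13_1
  set P13_3 := ∑ i ∈ Q3, p13 i with hP13_3
  set P12 := ∑ i ∈ Q3, p12 i with hP12
  set P23 := ∑ i ∈ Q1, p23 i with hP23
  have nPd1 : 0 ≤ Pd1 := Finset.sum_nonneg fun i _ => hpd i
  have nPd3 : 0 ≤ Pd3 := Finset.sum_nonneg fun i _ => hpd i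
  have nP13_1 : 0 ≤ P13_1 := Finset.sum_nonneg fun i _ => hp13 i
  have nP13_3 : 0 ≤ P13_3 := Finset.sum_nonneg fun i _ => hp13 i
  have nP12 : 0 ≤ P12 := Finset.sum_nonneg fun i _ => hp12 i
  have nP23 : 0 ≤ P23 := Finset.sum_nonneg fun i _ => hp23 i
  -- the target in aggregated form
  have goal_eq : -α * md1 + β * md3 - ε * m12_3 + γ * m13_13 - δ * m23_1 -
      (α * Pd1 - γ * P13_1 + δ * P23 + (-β * Pd3 + ε * P12 - γ * P13_3)) =
      -α * (md1 + Pd1) + β * (md3 + Pd3) + γ * (m13_13 + (P13_1 + P13_3)) - δ * (m23_1 + P23) - ε * (m12_3 + P12) := by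
    ring
  rw [goal_eq]
  set A1 := md1 + Pd1 with hA1
  set A3 := md3 + Pd3 with hA3
  set G := m13_13 + (P13_1 + P13_3) with hG
  set D1 := m23_1 + P23 with hD1
  set M12 := m12_3 + P12 with hM12
  have nA1 : 0 ≤ A1 := add_nonneg hmd1 nPd1
  have nA3 : 0 ≤ A3 := add_nonneg hmd3 nPd3
  have nG : 0 ≤ G := add_nonneg hm13_13 (add_nonneg nP13_1 nP13_3)
  have nD1 : 0 ≤ D1 := add_nonneg hm23_1 nP23
  have nM12 : 0 ≤ M12 := add_nonneg hm12_3 nP12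
  have b13' : Q13 * (A1 + A3) ≤ Qd * G := by rw [hA1, hA3, hG]; linarith [b13]
  have td' : A1 + A3 ≤ Qd := by rw [hA1, hA3]; linarith [td]
  -- `X' = −α A1 + β A3 + γ G − δ D1 ≥ 0` (the slack without the `ε`-term)
  have hX' : 0 ≤ -α * A1 + β * A3 + γ * G - δ * D1 := by
    rcases hQd.eq_or_lt with hQd0 | hQdpos
    · -- `d` null
      have zA1 : A1 = 0 := by linarith
      have zA3 : A3 = 0 := by linarith
      rcases hdeg hQd0.symm with ⟨h12, h13⟩ | ⟨h12, h23⟩ | ⟨h13, h23⟩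
      · have zG : G = 0 := by linarith
        rw [zA1, zA3, zG]
        rcases hQ23.eq_or_lt with hQ230 | hQ23pos
        · have zD1 : D1 = 0 := by linarith
          rw [zD1]; simp
        · have hQδ : Q23 * δ ≤ 0 := by rw [← hQd0, h13] at H1; linarith
          have hδ0 : δ = 0 := le_antisymm (by
            by_contra h; exact absurd hQδ (not_le.2 (mul_pos hQ23pos (lt_of_not_ge h)))) hδ
          rw [hδ0]; simp
      · have zD1 : D1 = 0 := by linarith
        rw [zA1, zA3, zD1]
        rcases hQ13.eq_or_lt with hQ130 | hQ13pos
        · have zG : G = 0 := by linarith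
          rw [zG]; simp
        · have hQγ : 0 ≤ Q13 * γ := by rw [← hQd0, h23] at H1; linarith
          have hγ : 0 ≤ γ := by
            by_contra h; exact absurd hQγ (not_le.2 (mul_neg_of_pos_of_neg hQ13pos (lt_of_not_ge h)))
          have g1 := mul_nonneg hγ nG
          linarith
      · have zG : G = 0 := by linarith
        have zD1 : D1 = 0 := by linarith
        rw [zA1, zA3, zG, zD1]; simp
    · rcases hQ13.eq_or_lt with hQ130 | hQ13pos
      · -- `[13]` null: `G = 0`, and the row forces `Q_d α = Q23 δ = 0`
        have zG : G = 0 := by linarith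
        have h0 : Qd * α + Q23 * δ ≤ 0 := by rw [← hQ130] at H1; linarith
        have hα0 : α = 0 := by
          have : Qd * α ≤ 0 := by linarith [mul_nonneg hQ23 hδ]
          exact le_antisymm (by by_contra h; exact absurd this (not_le.2 (mul_pos hQdpos (lt_of_not_ge h)))) hα
        have hQδ : Q23 * δ = 0 := le_antisymm (by linarith [mul_nonneg hQd hα]) (mul_nonneg hQ23 hδ)
        have hD : δ * D1 ≤ 0 := by
          have h1 : δ * (Qd * D1) ≤ δ * (Q23 * A1) := mul_le_mul_of_nonneg_left a23 hδ
          have h2 : δ * (Q23 * A1) = 0 := by rw [← mul_assoc, mul_comm δ Q23, hQδ, zero_mul]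
          have h4 : Qd * (δ * D1) ≤ 0 := by ring_nf at h1 h2 ⊢; linarith
          have := nonneg_of_mul_pos hQdpos (by linarith : 0 ≤ Qd * (-(δ * D1)))
          linarith
        rw [zG, hα0]
        have h5 := mul_nonneg hβ nA3
        ring_nf at h5 hD ⊢
        linarith
      · refine nonneg_of_mul_pos hQ13pos ?_
        have h1 : G * (Qd * α + Q23 * δ) ≤ G * (Q13 * γ) := mul_le_mul_of_nonneg_left H1 nG
        -- `Q_d (Q23 G − Q13 D1) ≥ 0`
        have h2 : Q23 * (Q13 * (A1 + A3)) ≤ Q23 * (Qd * G) := mul_le_mul_of_nonneg_left b13' hQ23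
        have h3 : Q13 * (Qd * D1) ≤ Q13 * (Q23 * A1) := mul_le_mul_of_nonneg_left a23 hQ13
        have h4 : 0 ≤ Qd * (Q23 * G - Q13 * D1) := by
          have h5 := mul_nonneg hQ23 (mul_nonneg hQ13 nA3)
          ring_nf at h2 h3 h5 ⊢; linarith
        have h5 : 0 ≤ Q23 * G - Q13 * D1 := nonneg_of_mul_pos hQdpos h4
        have h6 := mul_nonneg hδ h5
        have h7 := mul_nonneg hα (by linarith [b13', mul_nonneg hQ13 nA3] : 0 ≤ Qd * G - Q13 * A1)
        have h8 := mul_nonneg hβ (mul_nonneg hQ13 nA3)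
        ring_nf at h1 h6 h7 h8 ⊢
        linarith
  -- the `ε`-term
  rcases le_or_gt ε 0 with hε | hε
  · have h1 : ε * M12 ≤ 0 := mul_nonpos_of_nonpos_of_nonneg hε nM12
    linarith
  · rcases hQd.eq_or_lt with hQd0 | hQdpos
    · -- `d` null and `ε > 0`: `Q12 ε ≤ Q13 γ`; only the case `[13],[23]` null needs care
      have zA1 : A1 = 0 := by linarith
      have zA3 : A3 = 0 := by linarith
      rcases hdeg hQd0.symm with ⟨h12, -⟩ | ⟨h12, -⟩ | ⟨h13, h23⟩
      · have zM : M12 = 0 := by linarith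
        rw [zM, mul_zero, sub_zero]; exact hX'
      · have zM : M12 = 0 := by linarith
        rw [zM, mul_zero, sub_zero]; exact hX'
      · have hQε : Q12 * ε ≤ 0 := by rw [← hQd0, h13] at H3; linarith
        have hQ120 : Q12 = 0 := le_antisymm (by
          by_contra h; exact absurd hQε (not_le.2 (mul_pos (lt_of_not_ge h) hε))) hQ12
        have zM : M12 = 0 := by linarith
        rw [zM, mul_zero, sub_zero]; exact hX'
    · rcases hQ12.eq_or_lt with hQ120 | hQ12pos
      · have zM : M12 = 0 := by linarith
        rw [zM, mul_zero, sub_zero]; exact hX'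
      rcases hQ13.eq_or_lt with hQ130 | hQ13pos
      · -- `[13]` null: `G = 0`, `Q_d α = Q23 δ = 0`, and `Q12 (β A3 − ε M12) ≥ 0`
        have zG : G = 0 := by linarith
        have h0 : Qd * α + Q23 * δ ≤ 0 := by rw [← hQ130] at H1; linarith
        have hα0 : α = 0 := by
          have : Qd * α ≤ 0 := by linarith [mul_nonneg hQ23 hδ]
          exact le_antisymm (by by_contra h; exact absurd this (not_le.2 (mul_pos hQdpos (lt_of_not_ge h)))) hα
        have hQδ : Q23 * δ = 0 := le_antisymm (by linarith [mul_nonneg hQd hα]) (mul_nonneg hQ23 hδ)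
        have hD : δ * D1 ≤ 0 := by
          have h1 : δ * (Qd * D1) ≤ δ * (Q23 * A1) := mul_le_mul_of_nonneg_left a23 hδ
          have h2 : δ * (Q23 * A1) = 0 := by rw [← mul_assoc, mul_comm δ Q23, hQδ, zero_mul]
          have h4 : Qd * (δ * D1) ≤ 0 := by ring_nf at h1 h2 ⊢; linarith
          have := nonneg_of_mul_pos hQdpos (by linarith : 0 ≤ Qd * (-(δ * D1)))
          linarith
        have hE : Q12 * (ε * M12) ≤ β * (Q12 * A3) := by
          have h1 : M12 * (Q12 * ε) ≤ M12 * (Qd * β + Q13 * γ) := mul_le_mul_of_nonneg_left H3 nM12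
          have h2 : β * (Qd * M12) ≤ β * (Q12 * A3) := mul_le_mul_of_nonneg_left a12 hβ
          rw [← hQ130] at h1
          ring_nf at h1 h2 ⊢
          linarith
        refine nonneg_of_mul_pos hQ12pos ?_
        rw [zG, hα0]
        have h3 := mul_nonneg hQ12 (mul_nonneg hβ nA3)
        have h4 := mul_nonpos_of_nonneg_of_nonpos hQ12 hD
        ring_nf at hE h3 h4 ⊢
        linarith
      · -- main: `Q12 Q13 X ≥ 0`
        refine nonneg_of_mul_pos hQ12pos (nonneg_of_mul_pos hQ13pos ?_)
        have Ypos : 0 ≤ Q12 * G - Q13 * M12 := by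
          have h1 : Q12 * (Q13 * (A1 + A3)) ≤ Q12 * (Qd * G) := mul_le_mul_of_nonneg_left b13' hQ12
          have h2 : Q13 * (Qd * M12) ≤ Q13 * (Q12 * A3) := mul_le_mul_of_nonneg_left a12 hQ13
          have h4 : 0 ≤ Qd * (Q12 * G - Q13 * M12) := by
            have h5 := mul_nonneg hQ12 (mul_nonneg hQ13 nA1)
            ring_nf at h1 h2 h5 ⊢; linarith
          exact nonneg_of_mul_pos hQdpos h4
        have hEps : Q13 * (M12 * (Q12 * ε)) ≤ Q13 * (M12 * (Qd * β + Q13 * γ)) :=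
          mul_le_mul_of_nonneg_left (mul_le_mul_of_nonneg_left H3 nM12) hQ13
        have hGam : (Q12 * G - Q13 * M12) * (Qd * α + Q23 * δ) ≤ (Q12 * G - Q13 * M12) * (Q13 * γ) :=
          mul_le_mul_of_nonneg_left H1 Ypos
        -- the three brackets
        have br_a : 0 ≤ Qd * (Q12 * G - Q13 * M12) - Q12 * Q13 * A1 := by
          have h1 : Q12 * (Q13 * (A1 + A3)) ≤ Q12 * (Qd * G) := mul_le_mul_of_nonneg_left b13' hQ12
          have h2 : Q13 * (Qd * M12) ≤ Q13 * (Q12 * A3) := mul_le_mul_of_nonneg_left a12 hQ13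
          ring_nf at h1 h2 ⊢; linarith
        have br_b : 0 ≤ Q13 * (Q12 * A3 - Qd * M12) := mul_nonneg hQ13 (by linarith [a12])
        have br_d : 0 ≤ Q23 * (Q12 * G - Q13 * M12) - Q12 * Q13 * D1 := by
          have h1 : Q23 * (Q12 * (Q13 * (A1 + A3))) ≤ Q23 * (Q12 * (Qd * G)) :=
            mul_le_mul_of_nonneg_left (mul_le_mul_of_nonneg_left b13' hQ12) hQ23
          have h2 : Q23 * (Q13 * (Qd * M12)) ≤ Q23 * (Q13 * (Q12 * A3)) :=
            mul_le_mul_of_nonneg_left (mul_le_mul_of_nonneg_left a12 hQ13) hQ23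
          have h3 : Q12 * (Q13 * (Qd * D1)) ≤ Q12 * (Q13 * (Q23 * A1)) :=
            mul_le_mul_of_nonneg_left (mul_le_mul_of_nonneg_left a23 hQ13) hQ12
          have h4 : 0 ≤ Qd * (Q23 * (Q12 * G - Q13 * M12) - Q12 * Q13 * D1) := by
            ring_nf at h1 h2 h3 ⊢; linarith
          exact nonneg_of_mul_pos hQdpos h4
        have f1 := mul_nonneg hα br_a
        have f2 := mul_nonneg hβ br_b
        have f3 := mul_nonneg hδ br_d
        ring_nf at hEps hGam f1 f2 f3 ⊢
        linarith

end CaseMid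


end KNGoodR3

end Summit.CriticalPhenomena.PercolationContinuityZ3.Theorems
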